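import Literature.Probability.Percolation.TwoAvoidanceSets
import Literature.Probability.Percolation.TwoClusterConditionalAssociationProofs
import HarnessLib

/-!
# `NoHeavyLowerTail` (stmt-CriticalPhenomena-4575) — core attraction: the first random-core row beyond BHK

Support file (prover `prim-lf-1`, lemma factory #1; `--supports stmt-CriticalPhenomena-4575`).  No definitions,
no named facts, no sorries.

Setting of the random-core ("floating sink") calculus (`…CoreExchange.lean`): bond percolation `μ = prodBernoulli w`
on a finite vertex type, a core `R` with anchor `c ∈ R`, `Γ = ⋂_{r ∈ R} {c ↔ r}` ("the core is internally
connected"), a vertex `b` and an observer `o`.  Given `Γ`, the core cluster `C_R` either contains `b`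
(`R ⊆ C_b`) or is disjoint from `C_b` ("the core is free").

THEOREM (`coreAttraction`, seat memo CANDIDATES.md BATCH 8 (8c), "T1′"):
  `μ(Γ ∩ {b↔o} ∩ {b↮c}) · μ({b↮o} ∩ {R ⊆ C_b}) ≤ μ({b↔o} ∩ {R ⊆ C_b}) · μ(Γ ∩ {b↮o} ∩ {b↮c})`,
i.e. the `2 × 2` table (rows: `o ∈ C_b` / `o ∉ C_b`; columns: core swallowed by `C_b` / core free but connected)
has a nonnegative determinant: `o` and the connected random core are positively dependent with respect to
membership in a third cluster.  It is NOT an instance of van den Berg–Häggström–Kahn's two-cluster calculus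
(the event "core free and connected" is of neither type); the proof is Harris' inequality twice, the point being
that `ρ(ω) := 1{R ∩ C_b = ∅} · P(Γ | C_b)` is a DECREASING function of the configuration (a larger `C_b` leaves
fewer vertices for the core's internal connection), although `Γ` itself is increasing:
`E[f h] ≥ E[f] E[h]` and `E[f ρ] ≤ E[f] E[ρ]` for `f = 1{b↔o}`, `h = 1{R ⊆ C_b}` give `E[fh]·E[ρ] ≥ E[h]·E[fρ]`,
which rearranges to the claim.  The identification `E[f ρ] = μ(Γ ∩ {b↔o} ∩ {b↮c})` is BHK's display (10)
(domain Markov property, tree lemma `BHK2006.sum_cond_cluster` with `s = b`, `t = c`).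
-/

noncomputable section

namespace Summit.CriticalPhenomena.PercolationContinuityZ3.Theorems

open MeasureTheory Set Literature.Probability.LatticeModels Literature.Probability.Percolation
open BHK2006 DecisionTree TwoAvoidanceSets
open scoped Classical BigOperators

namespace CoreAttraction

variable {V : Type*} [Fintype V]

omit [Fintype V] in
/-- `1{x ↔ y}` is increasing in the configuration. [folklore] -/
theorem ind_openConn_mono (x y : V) :
    Monotone fun ω : Set (Sym2 V) => ind (openConn x y : Set (BondConfig V)) ω := by
  intro ω ω' h
  show ind (openConn x y : Set (BondConfig V)) ω ≤ ind (openConn x y : Set (BondConfig V)) ω'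
  by_cases hω : ω ∈ (openConn x y : Set (BondConfig V))
  · have hω' : ω' ∈ (openConn x y : Set (BondConfig V)) := by
      change (openGraph ω').Reachable x y
      exact (show (openGraph ω).Reachable x y from hω).mono (openGraph_le h)
    rw [ind_of_mem hω, ind_of_mem hω']
  · rw [ind_of_not_mem hω]; exact ind_nonneg _ _

omit [Fintype V] in
/-- `1{x ↮ y}` is decreasing in the configuration. [folklore] -/
theorem ind_compl_openConn_anti (x y : V) :
    Antitone fun ω : Set (Sym2 V) => ind ((openConn x y : Set (BondConfig V))ᶜ) ω := by
  intro ω ω' h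
  show ind ((openConn x y : Set (BondConfig V))ᶜ) ω' ≤ ind ((openConn x y : Set (BondConfig V))ᶜ) ω
  by_cases hω' : ω' ∈ ((openConn x y : Set (BondConfig V))ᶜ)
  · have hω : ω ∈ ((openConn x y : Set (BondConfig V))ᶜ) := by
      intro hr
      exact hω' ((show (openGraph ω).Reachable x y from hr).mono (openGraph_le h))
    rw [ind_of_mem hω, ind_of_mem hω']
  · rw [ind_of_not_mem hω']; exact ind_nonneg _ _

/-- `1_{Aᶜ ∩ B} = 1_B - 1_A · 1_B`. [folklore] -/
theorem ind_compl_inter {α : Type*} (A B : Set α) (x : α) :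
    ind (Aᶜ ∩ B) x = ind B x - ind A x * ind B x := by
  by_cases hA : x ∈ A <;> by_cases hB : x ∈ B <;>
    simp [ind_of_mem, ind_of_not_mem, hA, hB, Set.mem_inter_iff, Set.mem_compl_iff]

/-- **Core attraction** (random-core row "T1′"; see the module docstring): for `c ∈ R`,
`μ(Γ ∩ {b↔o} ∩ {b↮c}) · μ({b↮o} ∩ ⋂_{r∈R}{b↔r}) ≤ μ({b↔o} ∩ ⋂_{r∈R}{b↔r}) · μ(Γ ∩ {b↮o} ∩ {b↮c})`,
`Γ = ⋂_{r ∈ R} {c ↔ r}`.  Proof: Harris twice + the domain Markov property of `C_b`. [this file] -/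
theorem coreAttraction (w : Sym2 V → unitInterval) (o b c : V) (R : Finset V) :
    (prodBernoulli w).real ((⋂ r ∈ R, (openConn c r : Set (BondConfig V))) ∩ openConn b o ∩ (openConn b c)ᶜ) *
        (prodBernoulli w).real ((openConn b o : Set (BondConfig V))ᶜ ∩ ⋂ r ∈ R, openConn b r) ≤
      (prodBernoulli w).real ((openConn b o : Set (BondConfig V)) ∩ ⋂ r ∈ R, openConn b r) *
        (prodBernoulli w).real ((⋂ r ∈ R, (openConn c r : Set (BondConfig V))) ∩ (openConn b o)ᶜ ∩
          (openConn b c)ᶜ) := by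
  classical
  set w' : Sym2 V → ℝ := fun e => (w e : ℝ) with hw'
  have hw0 : ∀ e, 0 ≤ w' e := fun e => (w e).2.1
  have hw1 : ∀ e, w' e ≤ 1 := fun e => (w e).2.2
  have hm : ∑ ω, weight w' ω = 1 := by
    have h1 := integral_prodBernoulli_eq_sum w fun _ => (1 : ℝ)
    simp only [integral_const, probReal_univ, smul_eq_mul, mul_one] at h1
    exact h1.symm
  -- events and their indicators
  set Γ : Set (BondConfig V) := ⋂ r ∈ R, (openConn c r : Set (BondConfig V)) with hΓ
  set Bo : Set (BondConfig V) := openConn b o with hBo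
  set HB : Set (BondConfig V) := ⋂ r ∈ R, (openConn b r : Set (BondConfig V)) with hHB
  set D : Set (BondConfig V) := (openConn b c : Set (BondConfig V))ᶜ with hDdef
  have hD : ∀ ω, ω ∈ D ↔ ¬ (openGraph ω).Reachable b c := fun ω => Iff.rfl
  let F : Set (Sym2 V) → ℝ := fun ω => ind Bo ω
  let Hh : Set (Sym2 V) → ℝ := fun ω => ind HB ω
  -- `Γ` and `{b ↔ o}` read off the edge clusters
  let G : Set (Sym2 V) → ℝ := fun E => if ∀ r ∈ R, r = c ∨ ∃ e ∈ E, r ∈ e then 1 else 0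
  let fo : Set (Sym2 V) → ℝ := fun W => if o = b ∨ ∃ e ∈ W, o ∈ e then 1 else 0
  have hG : ∀ ω : Set (Sym2 V), G (openEdgeCluster ω c) = ind Γ ω := by
    intro ω
    have : (∀ r ∈ R, r = c ∨ ∃ e ∈ openEdgeCluster ω c, r ∈ e) ↔ ω ∈ Γ := by
      simp only [hΓ, Set.mem_iInter]
      refine forall₂_congr fun r _ => ?_
      rw [← reachable_iff_exists_mem_openEdgeCluster]; rfl
    by_cases h : ω ∈ Γ
    · simp only [G, if_pos (this.2 h), ind_of_mem h]
    · simp only [G, if_neg (fun h' => h (this.1 h')), ind_of_not_mem h]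
  have hfo : ∀ ω : Set (Sym2 V), fo (openEdgeCluster ω b) = F ω := by
    intro ω
    have : (o = b ∨ ∃ e ∈ openEdgeCluster ω b, o ∈ e) ↔ ω ∈ Bo := by
      rw [← reachable_iff_exists_mem_openEdgeCluster]; rfl
    by_cases h : ω ∈ Bo
    · simp only [fo, F, if_pos (this.2 h), ind_of_mem h]
    · simp only [fo, F, if_neg (fun h' => h (this.1 h')), ind_of_not_mem h]
  have hG0 : ∀ E, 0 ≤ G E := fun E => by simp only [G]; split_ifs <;> norm_num
  have hG1 : ∀ E, G E ≤ 1 := fun E => by simp only [G]; split_ifs <;> norm_num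
  have hGmono : Monotone G := monotone_FO c R
  -- the decreasing weight `ρ`
  let Abar : Set (Sym2 V) → Set (Sym2 V) := fun W => {e | ∃ v ∈ e, v = b ∨ ∃ e' ∈ W, v ∈ e'}
  let ρt : Set (Sym2 V) → ℝ := fun ω =>
    ∑ η, weight w' η * G (openEdgeCluster (η \ Abar (openEdgeCluster ω b)) c)
  let ρ : Set (Sym2 V) → ℝ := fun ω => ρt ω * ind D ω
  have hρt0 : ∀ ω, 0 ≤ ρt ω := fun ω =>
    Finset.sum_nonneg fun η _ => mul_nonneg (weight_nonneg hw0 hw1 η) (hG0 _)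
  have hρt1 : ∀ ω, ρt ω ≤ 1 := by
    intro ω
    calc ρt ω ≤ ∑ η, weight w' η * 1 :=
          Finset.sum_le_sum fun η _ => mul_le_mul_of_nonneg_left (hG1 _) (weight_nonneg hw0 hw1 η)
      _ = 1 := by simp [hm]
  have hρt_anti : Antitone ρt := by
    intro ω ω' hle
    refine Finset.sum_le_sum fun η _ => mul_le_mul_of_nonneg_left ?_ (weight_nonneg hw0 hw1 η)
    refine hGmono (openEdgeCluster_mono (fun e he => ?_) c)
    -- `η \ Abar (C_b ω') ⊆ η \ Abar (C_b ω)`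
    refine ⟨he.1, fun hA => he.2 ?_⟩
    obtain ⟨v, hv, hvb⟩ := hA
    refine ⟨v, hv, hvb.imp id fun ⟨e', he', hve'⟩ => ⟨e', openEdgeCluster_mono hle b he', hve'⟩⟩
  have hρ_anti : Antitone ρ := by
    intro ω ω' hle
    exact mul_le_mul (hρt_anti hle) (ind_compl_openConn_anti b c hle) (ind_nonneg _ _) (hρt0 _)
  have hρ1 : ∀ ω, ρ ω ≤ 1 := fun ω =>
    (mul_le_mul (hρt1 ω) (ind_le_one D ω) (ind_nonneg _ _) zero_le_one).trans (by norm_num)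
  have hF0 : ∀ ω, 0 ≤ F ω := fun ω => ind_nonneg _ _
  have hH0 : ∀ ω, 0 ≤ Hh ω := fun ω => ind_nonneg _ _
  have hFmono : Monotone F := ind_openConn_mono b o
  have hHmono : Monotone Hh := by
    intro ω ω' h
    by_cases hω : ω ∈ HB
    · have hω' : ω' ∈ HB := by
        simp only [hHB, Set.mem_iInter] at hω ⊢
        intro r hr
        exact (show (openGraph ω).Reachable b r from hω r hr).mono (openGraph_le h)
      simp only [Hh, ind_of_mem hω, ind_of_mem hω', le_refl]
    · simp only [Hh, ind_of_not_mem hω]; exact ind_nonneg _ _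
  -- the domain Markov property: `E[F ρ] = μ(Γ ∩ Bo ∩ D)` and `E[(1 - F) ρ] = μ(Γ ∩ Boᶜ ∩ D)`
  have markov : ∀ (φ : Set (Sym2 V) → ℝ),
      ∑ ω, weight w' ω * (φ (openEdgeCluster ω b) * G (openEdgeCluster ω c) * ind D ω) =
        ∑ ω, weight w' ω * (φ (openEdgeCluster ω b) * ρt ω * ind D ω) := by
    intro φ
    have key := sum_cond_cluster w' hm b c (fun W E => φ W * G E) hD
    rw [key]
    refine Finset.sum_congr rfl fun ω _ => ?_
    congr 1
    have e : ∑ η, weight w' η * (φ (openEdgeCluster ω b) *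
        G (openEdgeCluster (η \ {e | ∃ v ∈ e, v = b ∨ ∃ e' ∈ openEdgeCluster ω b, v ∈ e'}) c)) =
        φ (openEdgeCluster ω b) * ρt ω := by
      simp only [ρt, Abar, Finset.mul_sum]
      exact Finset.sum_congr rfl fun η _ => by ring
    rw [e]
  have hS_Fρ : ∑ ω, weight w' ω * (F ω * ρ ω) = (prodBernoulli w).real (Γ ∩ Bo ∩ D) := by
    rw [real_eq_sum_ind]
    have h1 := markov fo
    have e1 : ∀ ω, fo (openEdgeCluster ω b) * G (openEdgeCluster ω c) * ind D ω = ind (Γ ∩ Bo ∩ D) ω := by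
      intro ω; rw [hfo, hG, ind_inter, ind_inter]; simp only [F]; ring
    have e2 : ∀ ω, fo (openEdgeCluster ω b) * ρt ω * ind D ω = F ω * ρ ω := by
      intro ω; rw [hfo]; simp only [ρ]; ring
    simp only [e1, e2] at h1
    exact h1.symm
  have hS_nFρ : ∑ ω, weight w' ω * ((1 - F ω) * ρ ω) = (prodBernoulli w).real (Γ ∩ Boᶜ ∩ D) := by
    rw [real_eq_sum_ind]
    have h1 := markov (fun W => 1 - fo W)
    have e1 : ∀ ω, (1 - fo (openEdgeCluster ω b)) * G (openEdgeCluster ω c) * ind D ω =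
        ind (Γ ∩ Boᶜ ∩ D) ω := by
      intro ω
      rw [hfo, hG, ind_inter, show Γ ∩ Boᶜ = Boᶜ ∩ Γ from Set.inter_comm _ _, ind_compl_inter]
      simp only [F]; ring
    have e2 : ∀ ω, (1 - fo (openEdgeCluster ω b)) * ρt ω * ind D ω = (1 - F ω) * ρ ω := by
      intro ω; rw [hfo]; simp only [ρ]; ring
    simp only [e1, e2] at h1
    exact h1.symm
  have hS_FH : ∑ ω, weight w' ω * (F ω * Hh ω) = (prodBernoulli w).real (Bo ∩ HB) := by
    rw [real_eq_sum_ind]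
    refine Finset.sum_congr rfl fun ω _ => ?_
    rw [ind_inter]
  have hS_nFH : ∑ ω, weight w' ω * ((1 - F ω) * Hh ω) = (prodBernoulli w).real (Boᶜ ∩ HB) := by
    rw [real_eq_sum_ind]
    refine Finset.sum_congr rfl fun ω _ => ?_
    rw [ind_compl_inter]; simp only [F, Hh]; ring
  -- Harris twice
  have har1 := harris hw0 hw1 hF0 hH0 hFmono hHmono (w := w')
  rw [hm, one_mul] at har1
  have har2 := harris_mono_anti hw0 hw1 hm hF0 hFmono hρ_anti hρ1
  -- abbreviations
  set SF := ∑ ω, weight w' ω * F ω with hSF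
  set SH := ∑ ω, weight w' ω * Hh ω with hSH
  set SFH := ∑ ω, weight w' ω * (F ω * Hh ω) with hSFH
  set Sρ := ∑ ω, weight w' ω * ρ ω with hSρ
  set SFρ := ∑ ω, weight w' ω * (F ω * ρ ω) with hSFρ
  have lin1 : ∑ ω, weight w' ω * ((1 - F ω) * ρ ω) = Sρ - SFρ := by
    rw [hSρ, hSFρ, ← Finset.sum_sub_distrib]
    exact Finset.sum_congr rfl fun ω _ => by ring
  have lin2 : ∑ ω, weight w' ω * ((1 - F ω) * Hh ω) = SH - SFH := by
    rw [hSH, hSFH, ← Finset.sum_sub_distrib]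
    exact Finset.sum_congr rfl fun ω _ => by ring
  have hSH0 : 0 ≤ SH := Finset.sum_nonneg fun ω _ => mul_nonneg (weight_nonneg hw0 hw1 ω) (hH0 ω)
  have hSρ0 : 0 ≤ Sρ := Finset.sum_nonneg fun ω _ =>
    mul_nonneg (weight_nonneg hw0 hw1 ω) (mul_nonneg (hρt0 ω) (ind_nonneg _ _))
  have hSFρ0 : 0 ≤ SFρ := Finset.sum_nonneg fun ω _ =>
    mul_nonneg (weight_nonneg hw0 hw1 ω) (mul_nonneg (hF0 ω) (mul_nonneg (hρt0 ω) (ind_nonneg _ _)))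
  have hSFH0 : 0 ≤ SFH := Finset.sum_nonneg fun ω _ =>
    mul_nonneg (weight_nonneg hw0 hw1 ω) (mul_nonneg (hF0 ω) (hH0 ω))
  -- `SFH · Sρ ≥ SF · SH · Sρ ≥ SH · SFρ`
  have step : SH * SFρ ≤ SFH * Sρ := by
    have a1 : SF * SH * Sρ ≤ SFH * Sρ := mul_le_mul_of_nonneg_right har1 hSρ0
    have a2 : SH * SFρ ≤ SH * (SF * Sρ) := mul_le_mul_of_nonneg_left har2 hSH0
    nlinarith [a1, a2]
  -- rewrite the goal in terms of the sums
  have eBF : (prodBernoulli w).real (Γ ∩ Bo ∩ D) = SFρ := hS_Fρ.symm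
  have eNF : (prodBernoulli w).real (Γ ∩ Boᶜ ∩ D) = Sρ - SFρ := by rw [← hS_nFρ, lin1]
  have eBB : (prodBernoulli w).real (Bo ∩ HB) = SFH := hS_FH.symm
  have eNB : (prodBernoulli w).real (Boᶜ ∩ HB) = SH - SFH := by rw [← hS_nFH, lin2]
  rw [eBF, eNB, eBB, eNF]
  nlinarith [step, hSFρ0, hSFH0]

end CoreAttraction

end Summit.CriticalPhenomena.PercolationContinuityZ3.Theorems

end
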